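import Literature.AlgebraicGeometry.HodgeTheory.AbelianVarietyHOneExactness
import Literature.AlgebraicGeometry.Motives.AbelianVarietyImageSimpleProofs
import HarnessLib

/-!
# A homomorphism of complex abelian varieties with finite kernel has a LEFT quasi-inverse

Topic `Literature/AlgebraicGeometry/Motives`; namespace `Literature.AlgebraicGeometry.Motives.AbelianVariety`.  THEOREMS ONLY.

For `f : A ⟶ B` over `ℂ` with finitely many `ℂ`-points in its kernel there are `ψ : B ⟶ A` and `n ≥ 1` with
`f ≫ ψ = [n]_A` — WITHOUT any hypothesis on `dim B` (so `f` need not be an isogeny).  Road ([MumfordAV1970] §19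
Thm. 1 and Remark p. 169; [LangeBirkenhake1992] Prop. 1.1.15, Cor. 2.4.24): `A ↠ im f` has finite kernel and
`dim (im f) ≤ dim A`, hence is an isogeny (★ `isIsogeny_of_finite_of_dim_le`) with a quasi-inverse `τ`
(★ `IsIsogeny.exists_nsmul_inverse_holds`); the closed immersion `im f ↪ B` has a retraction up to `m`
(★ `exists_comp_eq_nsmul_id_of_isClosedImmersion`, Poincaré complete reducibility); `ψ := p ≫ τ`, `n := m·n₀`.

Cell `hodgecm-mathlib`, M1PRIME-DAG W3 λ-clause sub-goal (G3) of B-p03's list (one-sided rigidity input: the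
λ-clause consumer knows `λ̄′` has finite kernel but not `dim Â′ = dim A′`).  Banked generic leaf; HC_CM is proved only
modulo the printed citations until rung 0 closes.

## References
* [MumfordAV1970] D. Mumford, *Abelian Varieties* (1970), §19 Thm. 1 (pp. 173–174) and Remark p. 169.
* [LangeBirkenhake1992] H. Lange, Ch. Birkenhake, *Complex Abelian Varieties* (1992), Prop. 1.1.15, Cor. 2.4.24.
-/

noncomputable section

namespace Literature.AlgebraicGeometry.Motives.AbelianVariety

open CategoryTheory AlgebraicGeometry

variable {A B : AbelianVariety ℂ}

/-- A homomorphism of abelian varieties sends the unit point to the unit point on `L`-points (the induced map on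
`A(L) = Hom(Spec L, A)` is a group homomorphism, Mathlib `IsMonHom.monoidHom`). [folklore] -/
private theorem map_hom_one {K : Type} [Field K] {X Y : AbelianVariety K} {L : Type} [Field L] [Algebra K L]
    (χ : X ⟶ Y) : AlgPoints.map χ.hom.hom.hom (1 : X.Points L) = 1 := by
  have h := map_one (IsMonHom.monoidHom χ.hom.hom.hom (Literature.AlgebraicGeometry.Motives.specOver K L))
  simpa only [IsMonHom.monoidHom_apply, AlgPoints.map_apply] using h

/-- The kernel (on `ℂ`-points) of `A ↠ im f` is contained in that of `f`. [cite: MumfordAV1970, §19 Thm. 1 (p. 173)] -/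
theorem comp_toImage_eq_one_imp (f : A ⟶ B) {R : A.Points ℂ} (hR : R ≫ (toImage f).hom.hom.hom = 1) :
    R ≫ f.hom.hom.hom = 1 := by
  have h : AlgPoints.map f.hom.hom.hom R = AlgPoints.map (imageι f).hom.hom.hom (AlgPoints.map (toImage f).hom.hom.hom R) := by
    rw [← AlgPoints.map_comp_apply]
    change _ = AlgPoints.map (toImage f ≫ imageι f).hom.hom.hom R
    rw [toImage_imageι]
  rw [AlgPoints.map_apply] at h
  rw [h, AlgPoints.map_apply (toImage f).hom.hom.hom, hR]
  exact map_hom_one (imageι f)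

/-- **LEFT QUASI-INVERSE FOR A FINITE-KERNEL HOMOMORPHISM (over `ℂ`)**: if `f : A ⟶ B` has finitely many
`ℂ`-points in its kernel, then `f ≫ ψ = [n]_A` for some `ψ : B ⟶ A` and `n ≠ 0` — no hypothesis on `dim B`.
(`A ↠ im f` is an isogeny with quasi-inverse `τ`; `im f ↪ B` has a retraction `p` up to `m` by Poincaré complete
reducibility; `ψ := p ≫ τ`.) [cite: MumfordAV1970, §19 Thm. 1 (pp. 173–174) and Remark p. 169]
[cite: LangeBirkenhake1992, Prop. 1.1.15 and Cor. 2.4.24] -/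
theorem exists_comp_eq_zsmul_id_of_finite_kerPoints {A B : Motives.AbelianVariety ℂ} (f : A ⟶ B)
    (hfin : {P : A.Points ℂ | AlgPoints.map f.hom.hom.hom P = 1}.Finite) :
    ∃ (ψ : B ⟶ A) (n : ℕ), n ≠ 0 ∧ f ≫ ψ = (n : ℤ) • 𝟙 A := by
  -- `A ↠ im f` is an isogeny
  have hfin' : {R : A.Points ℂ | R ≫ (toImage f).hom.hom.hom = 1}.Finite :=
    hfin.subset fun R hR => comp_toImage_eq_one_imp f hR
  have hiso : IsIsogeny (toImage f) := isIsogeny_of_finite_of_dim_le (toImage f) hfin' (dim_image_le_left f)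
  -- its quasi-inverse `τ` and the retraction `p` of `im f ↪ B`
  obtain ⟨τ, n₀, hn₀, hτ, -⟩ := IsIsogeny.exists_nsmul_inverse_holds hiso
  obtain ⟨p, m, hm, hp⟩ := Literature.AlgebraicGeometry.HodgeTheory.exists_comp_eq_nsmul_id_of_isClosedImmersion (imageι f)
  refine ⟨p ≫ τ, m * n₀, mul_ne_zero hm hn₀.ne', ?_⟩
  calc f ≫ p ≫ τ = (toImage f ≫ imageι f) ≫ p ≫ τ := by rw [toImage_imageι]
    _ = toImage f ≫ (imageι f ≫ p) ≫ τ := by simp only [Category.assoc]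
    _ = ((m * n₀ : ℕ) : ℤ) • 𝟙 A := by
        rw [hp, Preadditive.nsmul_comp, Category.id_comp, Preadditive.comp_nsmul, hτ, smul_smul, natCast_zsmul]

end Literature.AlgebraicGeometry.Motives.AbelianVariety

end
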